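import Mathlib

/-!
# Homogenising a layered matrix product with affine layers: the counter construction

Helper file for item `DetReprLift` (stmt-ValiantsHypothesis-5924) of route `LiftNullstellensatz`
(`Summits/ValiantsHypothesis/ValiantsHypothesis/Theses/LiftNullstellensatz.lean`).

Fix a finite state type `S`, scalars `R`, letters `σ` and `m` *affine* layers
`𝒯_t = T⁰_t + Σ_s X_s T¹_{t,s}` (`symbLayer T0 T1 t`, a matrix over `MvPolynomial σ R` with
constant part `T0 t` and linear parts `T1 t s`, `t < m`).  The covector `α 𝒯_0 ⋯ 𝒯_{t-1}`
(`symbVec α T0 T1 t`) has polynomial entries of degree `≤ t`; its degree-`i` homogeneous component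
is computed by a UNIFORM tensor train on the states `S × Fin (m + 1)` ("state, number of layers
consumed") reading `i` letters: reading the letter `s` in state `(y, t')` one may consume any
number of constant layers `T⁰_{t'} ⋯ T⁰_{t-1}` and then the linear layer `T¹_{t,s}`, arriving at
`(x, t + 1)` (`cU T0 T1 m s`, with the ordered constant products `cprod T0 t' k`); the start
covector is `α` placed at counter `0` (`cα`) and the final vector absorbs the trailing constant
layers (`cβ`).  This is the standard homogenisation of an algebraic branching program with affine
edge labels (width multiplied by the number of layers `+ 1`).  Proved here:

* `symbVec_invariant` — `hc_i (α 𝒯_0 ⋯ 𝒯_{t-1}) = Σ_{t' ≤ t} W_i(·, t') · T⁰_{t'} ⋯ T⁰_{t-1}`,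
  where `W_i = symbW … i` is the symbolic counter covector after `i` letters;
* `homogeneousComponent_symbVec_dotProduct` — `hc_N (α 𝒯_0 ⋯ 𝒯_{m-1} β) = W_N ⬝ cβ`;
* `symbW_eq_vecMul_pow` — `W_i = cα · 𝒰^i` for the symbolic counter transition
  `𝒰 = Σ_s X_s · cU s` (`symbU`), the form consumed by the tensor-train lemmas of
  `LiftNullstellensatzDetReprLiftTensorTrain.lean`.

[folklore]
-/

namespace Summit.ValiantsHypothesis.ValiantsHypothesis.Theorems

-- the single-problem summit's namespace `Summit.ValiantsHypothesis.ValiantsHypothesis` repeats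
set_option linter.dupNamespace false

namespace DetReprLift

open Matrix MvPolynomial

noncomputable section

/-! ### Homogeneous components of a product with a variable -/

section HC

variable {R : Type*} [CommRing R] {σ : Type*}

/-- `hc_{i+1} (p · X_s) = hc_i (p) · X_s`. [folklore] -/
theorem homogeneousComponent_succ_mul_X (i : ℕ) (p : MvPolynomial σ R) (s : σ) :
    homogeneousComponent (i + 1) (p * X s) = homogeneousComponent i p * X s := by
  classical
  ext d
  rw [coeff_homogeneousComponent, coeff_mul_X', coeff_mul_X', coeff_homogeneousComponent]
  by_cases hs : s ∈ d.support
  · have hle : Finsupp.single s 1 ≤ d :=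
      Finsupp.single_le_iff.mpr (Nat.one_le_iff_ne_zero.mpr (Finsupp.mem_support_iff.mp hs))
    have hdeg : d.degree = (d - Finsupp.single s 1).degree + 1 := by
      conv_lhs => rw [← tsub_add_cancel_of_le hle]
      rw [map_add, Finsupp.degree_single]
    simp only [if_pos hs, hdeg, add_left_inj]
  · simp [hs]

/-- `hc_0 (p · X_s) = 0`. [folklore] -/
theorem homogeneousComponent_zero_mul_X (p : MvPolynomial σ R) (s : σ) :
    homogeneousComponent 0 (p * X s) = 0 := by
  classical
  rw [homogeneousComponent_zero, coeff_mul_X', if_neg (by simp), C_0]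

/-- `hc_i (p · C c) = hc_i (p) · C c`. [folklore] -/
theorem homogeneousComponent_mul_C (i : ℕ) (p : MvPolynomial σ R) (c : R) :
    homogeneousComponent i (p * C c) = homogeneousComponent i p * C c := by
  rw [mul_comm, homogeneousComponent_C_mul, mul_comm]

/-- `hc_i (C c) = [i = 0] C c`. [folklore] -/
theorem homogeneousComponent_C' (i : ℕ) (c : R) :
    homogeneousComponent i (C c : MvPolynomial σ R) = if i = 0 then C c else 0 :=
  homogeneousComponent_of_mem (isHomogeneous_C σ c)

end HC

/-! ### Affine layers and their symbolic product -/

section Layers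

variable {R : Type*} [CommRing R] {S : Type*} {σ : Type*} [Fintype σ]

/-- The **affine layer** `𝒯_t = T⁰_t + Σ_s X_s · T¹_{t,s}` over `MvPolynomial σ R`. [folklore] -/
def symbLayer (T0 : ℕ → Matrix S S R) (T1 : ℕ → σ → Matrix S S R) (t : ℕ) :
    Matrix S S (MvPolynomial σ R) :=
  (T0 t).map C + ∑ s, (X s : MvPolynomial σ R) • (T1 t s).map C

/-- Entries of the affine layer. [folklore] -/
theorem symbLayer_apply (T0 : ℕ → Matrix S S R) (T1 : ℕ → σ → Matrix S S R) (t : ℕ) (y x : S) :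
    symbLayer T0 T1 t y x = C (T0 t y x) + ∑ s, X s * C (T1 t s y x) := by
  simp only [symbLayer, Matrix.add_apply, Matrix.map_apply, Matrix.sum_apply, Matrix.smul_apply,
    smul_eq_mul]

variable [Fintype S]

/-- The **symbolic covector** `α 𝒯_0 ⋯ 𝒯_{t-1}` after `t` affine layers. [folklore] -/
def symbVec (α : S → R) (T0 : ℕ → Matrix S S R) (T1 : ℕ → σ → Matrix S S R) :
    ℕ → S → MvPolynomial σ R
  | 0 => fun x => C (α x)
  | t + 1 => symbVec α T0 T1 t ᵥ* symbLayer T0 T1 t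

/-- `symbVec` at `0`. [folklore] -/
@[simp] theorem symbVec_zero (α : S → R) (T0 : ℕ → Matrix S S R) (T1 : ℕ → σ → Matrix S S R) :
    symbVec α T0 T1 0 = fun x => C (α x) := rfl

/-- `symbVec` at a successor. [folklore] -/
theorem symbVec_succ (α : S → R) (T0 : ℕ → Matrix S S R) (T1 : ℕ → σ → Matrix S S R) (t : ℕ) :
    symbVec α T0 T1 (t + 1) = symbVec α T0 T1 t ᵥ* symbLayer T0 T1 t := rfl

/-- `symbVec` at a successor, coordinatewise. [folklore] -/
theorem symbVec_succ_apply (α : S → R) (T0 : ℕ → Matrix S S R) (T1 : ℕ → σ → Matrix S S R)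
    (t : ℕ) (x : S) :
    symbVec α T0 T1 (t + 1) x = ∑ y, symbVec α T0 T1 t y * symbLayer T0 T1 t y x := rfl

end Layers

/-! ### The counter tensor train -/

section Counter

variable {R : Type*} [CommRing R] {S : Type*} {σ : Type*}

/-- **Counter start covector**: `α` at counter value `0`. [folklore] -/
def cα (α : S → R) (m : ℕ) : S × Fin (m + 1) → R :=
  fun p => if (p.2 : ℕ) = 0 then α p.1 else 0

variable [Fintype S] [DecidableEq S]

/-- Ordered product of the constant layers `T⁰_t T⁰_{t+1} ⋯ T⁰_{t+k-1}` (`k` factors). [folklore] -/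
def cprod (T0 : ℕ → Matrix S S R) (t : ℕ) : ℕ → Matrix S S R
  | 0 => 1
  | k + 1 => cprod T0 t k * T0 (t + k)

/-- `cprod` with no factor. [folklore] -/
@[simp] theorem cprod_zero (T0 : ℕ → Matrix S S R) (t : ℕ) : cprod T0 t 0 = 1 := rfl

/-- `cprod` with one more factor. [folklore] -/
theorem cprod_succ (T0 : ℕ → Matrix S S R) (t k : ℕ) :
    cprod T0 t (k + 1) = cprod T0 t k * T0 (t + k) := rfl

/-- Extending the constant product from `[t', t)` to `[t', t + 1)`. [folklore] -/
theorem cprod_sub_succ (T0 : ℕ → Matrix S S R) {t' t : ℕ} (h : t' ≤ t) :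
    cprod T0 t' (t + 1 - t') = cprod T0 t' (t - t') * T0 t := by
  rw [Nat.succ_sub h, cprod_succ, Nat.add_sub_cancel' h]

/-- **Counter transition** for the letter `s`: from `(y, t')` to `(x, t)` with `t' < t`, consume the
constant layers `T⁰_{t'} ⋯ T⁰_{t-2}` and then the linear layer `T¹_{t-1,s}`. [folklore] -/
def cU (T0 : ℕ → Matrix S S R) (T1 : ℕ → σ → Matrix S S R) (m : ℕ) (s : σ) :
    Matrix (S × Fin (m + 1)) (S × Fin (m + 1)) R :=
  Matrix.of fun p q =>
    if (p.2 : ℕ) < q.2 then (cprod T0 p.2 (q.2 - 1 - p.2) * T1 (q.2 - 1) s) p.1 q.1 else 0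

/-- No transition enters counter value `0`. [folklore] -/
theorem cU_apply_zero (T0 : ℕ → Matrix S S R) (T1 : ℕ → σ → Matrix S S R) (m : ℕ) (s : σ)
    (p : S × Fin (m + 1)) (x : S) : cU T0 T1 m s p (x, 0) = 0 := by
  simp [cU]

/-- Transitions entering counter value `t + 1`: allowed from `t' ≤ t`, with weight
`(T⁰_{t'} ⋯ T⁰_{t-1} · T¹_{t,s})`. [folklore] -/
theorem cU_apply_succ (T0 : ℕ → Matrix S S R) (T1 : ℕ → σ → Matrix S S R) (m : ℕ) (s : σ)
    (p : S × Fin (m + 1)) (x : S) (t : ℕ) (ht : t + 1 < m + 1) :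
    cU T0 T1 m s p (x, ⟨t + 1, ht⟩) =
      if (p.2 : ℕ) ≤ t then (cprod T0 p.2 (t - p.2) * T1 t s) p.1 x else 0 := by
  simp only [cU, Matrix.of_apply, Nat.lt_succ_iff, Nat.add_sub_cancel]

/-- **Counter final vector**: absorb the trailing constant layers `T⁰_{t'} ⋯ T⁰_{m-1}` into `β`.
[folklore] -/
def cβ (T0 : ℕ → Matrix S S R) (β : S → R) (m : ℕ) : S × Fin (m + 1) → R :=
  fun p => (cprod T0 p.2 (m - p.2) *ᵥ β) p.1

variable [Fintype σ]

/-- The **symbolic counter transition** `𝒰 = Σ_s X_s · cU s`. [folklore] -/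
def symbU (T0 : ℕ → Matrix S S R) (T1 : ℕ → σ → Matrix S S R) (m : ℕ) :
    Matrix (S × Fin (m + 1)) (S × Fin (m + 1)) (MvPolynomial σ R) :=
  ∑ s, (X s : MvPolynomial σ R) • (cU T0 T1 m s).map C

/-- Entries of the symbolic counter transition. [folklore] -/
theorem symbU_apply (T0 : ℕ → Matrix S S R) (T1 : ℕ → σ → Matrix S S R) (m : ℕ)
    (p q : S × Fin (m + 1)) :
    symbU T0 T1 m p q = ∑ s, X s * C (cU T0 T1 m s p q) := by
  simp only [symbU, Matrix.sum_apply, Matrix.smul_apply, Matrix.map_apply, smul_eq_mul]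

/-- The **symbolic counter covector** after `i` letters. [folklore] -/
def symbW (α : S → R) (T0 : ℕ → Matrix S S R) (T1 : ℕ → σ → Matrix S S R) (m : ℕ) :
    ℕ → S × Fin (m + 1) → MvPolynomial σ R
  | 0 => fun p => C (cα α m p)
  | i + 1 => symbW α T0 T1 m i ᵥ* symbU T0 T1 m

variable (α : S → R) (T0 : ℕ → Matrix S S R) (T1 : ℕ → σ → Matrix S S R) (m : ℕ)

/-- `symbW` at `0`, coordinatewise. [folklore] -/
theorem symbW_zero_apply (p : S × Fin (m + 1)) :
    symbW α T0 T1 m 0 p = if (p.2 : ℕ) = 0 then C (α p.1) else 0 := by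
  change C (cα α m p) = _
  unfold cα
  split_ifs <;> simp

/-- `symbW` at a successor, coordinatewise. [folklore] -/
theorem symbW_succ_apply (i : ℕ) (q : S × Fin (m + 1)) :
    symbW α T0 T1 m (i + 1) q = ∑ p, symbW α T0 T1 m i p * symbU T0 T1 m p q := rfl

/-- The counter covector at counter value `0`: only before reading any letter. [folklore] -/
theorem symbW_apply_zero (i : ℕ) (x : S) :
    symbW α T0 T1 m i (x, 0) = if i = 0 then C (α x) else 0 := by
  rcases i with _ | i
  · simp [symbW_zero_apply]
  · rw [symbW_succ_apply, if_neg (Nat.succ_ne_zero i)]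
    refine Finset.sum_eq_zero fun p _ => ?_
    rw [symbU_apply, Finset.sum_eq_zero fun s _ => by rw [cU_apply_zero, C_0, mul_zero], mul_zero]

/-- Before reading any letter the counter is `0`. [folklore] -/
theorem symbW_zero_apply_succ (x : S) (t : ℕ) (ht : t + 1 < m + 1) :
    symbW α T0 T1 m 0 (x, ⟨t + 1, ht⟩) = 0 := by
  rw [symbW_zero_apply, if_neg (Nat.succ_ne_zero t)]

/-- **Reading one more letter**: the contribution of the linear parts of layer `t`, fed by the
counter covector at values `t' ≤ t` through the constant layers in between, is the counter covector
at counter value `t + 1`. [folklore] -/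
theorem symbW_apply_succ (i : ℕ) (x : S) (t : ℕ) (ht : t + 1 < m + 1) :
    symbW α T0 T1 m (i + 1) (x, ⟨t + 1, ht⟩) =
      ∑ p : S × Fin (m + 1), if (p.2 : ℕ) ≤ t then
        symbW α T0 T1 m i p * ∑ s, X s * C ((cprod T0 p.2 (t - p.2) * T1 t s) p.1 x) else 0 := by
  rw [symbW_succ_apply]
  refine Finset.sum_congr rfl fun p _ => ?_
  rw [symbU_apply]
  split_ifs with h
  · simp_rw [cU_apply_succ, if_pos h]
  · rw [Finset.sum_eq_zero fun s _ => by rw [cU_apply_succ, if_neg h, C_0, mul_zero], mul_zero]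

/-! ### The invariant -/

/-- **The counter invariant**: for `t ≤ m`, the degree-`i` homogeneous component of the symbolic
covector after `t` affine layers is `Σ_{t' ≤ t} W_i(·, t') · T⁰_{t'} ⋯ T⁰_{t-1}` — the counter
covector after `i` letters at counter value `t'`, pushed through the remaining constant layers.
[folklore] -/
theorem symbVec_invariant (t : ℕ) (ht : t ≤ m) (i : ℕ) (x : S) :
    homogeneousComponent i (symbVec α T0 T1 t x) =
      ∑ p : S × Fin (m + 1), if (p.2 : ℕ) ≤ t then
        symbW α T0 T1 m i p * C (cprod T0 p.2 (t - p.2) p.1 x) else 0 := by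
  induction t generalizing i x with
  | zero =>
    show homogeneousComponent i (C (α x)) = _
    rw [homogeneousComponent_C', Fintype.sum_prod_type]
    have inner : ∀ y : S, (∑ t' : Fin (m + 1), if ((t' : ℕ) ≤ 0) then
        symbW α T0 T1 m i (y, t') * C (cprod T0 t' (0 - t') y x) else 0) =
        symbW α T0 T1 m i (y, 0) * C ((1 : Matrix S S R) y x) := by
      intro y
      rw [Finset.sum_eq_single (0 : Fin (m + 1))]
      · simp
      · intro t' _ ht'
        rw [if_neg]
        exact fun h => ht' (Fin.ext (by rw [Fin.val_zero]; exact Nat.le_zero.mp h))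
      · intro h; exact absurd (Finset.mem_univ _) h
    simp_rw [inner, symbW_apply_zero, Matrix.one_apply]
    rw [Finset.sum_eq_single x]
    · simp
    · intro y _ hy; simp [hy]
    · intro h; exact absurd (Finset.mem_univ _) h
  | succ t ih =>
    have htm : t + 1 < m + 1 := by omega
    have ht' : t ≤ m := by omega
    -- expand the last affine layer and distribute `hc_i`
    have hL : homogeneousComponent i (symbVec α T0 T1 (t + 1) x) =
        (∑ y, homogeneousComponent i (symbVec α T0 T1 t y) * C (T0 t y x)) +
          ∑ y, ∑ s, homogeneousComponent i (symbVec α T0 T1 t y * X s) * C (T1 t s y x) := by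
      rw [symbVec_succ_apply, map_sum, ← Finset.sum_add_distrib]
      refine Finset.sum_congr rfl fun y _ => ?_
      rw [symbLayer_apply, mul_add, map_add, homogeneousComponent_mul_C, Finset.mul_sum, map_sum]
      congr 1
      refine Finset.sum_congr rfl fun s _ => ?_
      rw [← mul_assoc, homogeneousComponent_mul_C]
    -- constant parts: push the invariant at `t` through `T⁰_t`
    have hT0 : (∑ y, homogeneousComponent i (symbVec α T0 T1 t y) * C (T0 t y x)) =
        ∑ p : S × Fin (m + 1), if (p.2 : ℕ) ≤ t then
          symbW α T0 T1 m i p * C (cprod T0 p.2 (t + 1 - p.2) p.1 x) else 0 := by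
      simp_rw [ih ht', Finset.sum_mul, ite_mul, zero_mul]
      rw [Finset.sum_comm]
      refine Finset.sum_congr rfl fun p _ => ?_
      split_ifs with hp
      · rw [cprod_sub_succ T0 hp, Matrix.mul_apply, map_sum, Finset.mul_sum]
        refine Finset.sum_congr rfl fun y _ => ?_
        rw [map_mul, mul_assoc]
      · exact Finset.sum_const_zero
    -- linear parts: this is exactly one more letter of the counter train
    have hE : (∑ y, ∑ s, homogeneousComponent i (symbVec α T0 T1 t y * X s) * C (T1 t s y x)) =
        symbW α T0 T1 m i (x, ⟨t + 1, htm⟩) := by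
      rcases i with _ | i
      · simp_rw [homogeneousComponent_zero_mul_X, zero_mul, Finset.sum_const_zero]
        rw [symbW_zero_apply_succ]
      · simp_rw [homogeneousComponent_succ_mul_X, ih ht' i, Finset.sum_mul, ite_mul, zero_mul]
        rw [symbW_apply_succ]
        calc (∑ y, ∑ s, ∑ p : S × Fin (m + 1), if (p.2 : ℕ) ≤ t then
              symbW α T0 T1 m i p * C (cprod T0 p.2 (t - p.2) p.1 y) * X s * C (T1 t s y x) else 0)
            = ∑ y, ∑ p : S × Fin (m + 1), ∑ s, if (p.2 : ℕ) ≤ t then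
              symbW α T0 T1 m i p * C (cprod T0 p.2 (t - p.2) p.1 y) * X s * C (T1 t s y x)
                else 0 := Finset.sum_congr rfl fun y _ => Finset.sum_comm
          _ = ∑ p : S × Fin (m + 1), ∑ y, ∑ s, if (p.2 : ℕ) ≤ t then
              symbW α T0 T1 m i p * C (cprod T0 p.2 (t - p.2) p.1 y) * X s * C (T1 t s y x)
                else 0 := Finset.sum_comm
          _ = _ := Finset.sum_congr rfl fun p _ => ?_
        split_ifs with hp
        · rw [Finset.mul_sum, Finset.sum_comm]
          refine Finset.sum_congr rfl fun s _ => ?_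
          rw [Matrix.mul_apply, map_sum, Finset.mul_sum, Finset.mul_sum]
          refine Finset.sum_congr rfl fun y _ => ?_
          rw [map_mul]
          ring
        · simp
    -- assemble: split `[t' ≤ t + 1] = [t' ≤ t] + [t' = t + 1]`
    rw [hL, hT0, hE]
    have hsplit : ∀ p : S × Fin (m + 1),
        (if (p.2 : ℕ) ≤ t + 1 then symbW α T0 T1 m i p * C (cprod T0 p.2 (t + 1 - p.2) p.1 x)
          else 0) =
        (if (p.2 : ℕ) ≤ t then symbW α T0 T1 m i p * C (cprod T0 p.2 (t + 1 - p.2) p.1 x)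
          else 0) +
        (if (p.2 : ℕ) = t + 1 then symbW α T0 T1 m i p * C (cprod T0 p.2 (t + 1 - p.2) p.1 x)
          else 0) := by
      intro p
      by_cases h1 : (p.2 : ℕ) ≤ t
      · rw [if_pos (by omega), if_pos h1, if_neg (by omega), add_zero]
      · by_cases h2 : (p.2 : ℕ) = t + 1
        · rw [if_pos (by omega), if_neg h1, if_pos h2, zero_add]
        · rw [if_neg (by omega), if_neg h1, if_neg h2, add_zero]
    rw [Finset.sum_congr rfl fun p _ => hsplit p, Finset.sum_add_distrib]
    congr 1
    symm
    rw [Fintype.sum_prod_type]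
    have inner : ∀ y : S, (∑ t' : Fin (m + 1), if ((t' : ℕ) = t + 1) then
        symbW α T0 T1 m i (y, t') * C (cprod T0 t' (t + 1 - t') y x) else 0) =
        symbW α T0 T1 m i (y, ⟨t + 1, htm⟩) * C ((1 : Matrix S S R) y x) := by
      intro y
      rw [Finset.sum_eq_single ⟨t + 1, htm⟩]
      · rw [if_pos rfl, Nat.sub_self, cprod_zero]
      · intro t' _ ht'
        rw [if_neg]
        exact fun h => ht' (Fin.ext h)
      · intro h; exact absurd (Finset.mem_univ _) h
    simp_rw [inner, Matrix.one_apply]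
    rw [Finset.sum_eq_single x]
    · simp
    · intro y _ hy; simp [hy]
    · intro h; exact absurd (Finset.mem_univ _) h

/-- **The top component through the final vector**: `hc_N (α 𝒯_0 ⋯ 𝒯_{m-1} β) = W_N ⬝ cβ`.
[folklore] -/
theorem homogeneousComponent_symbVec_dotProduct (β : S → R) (N : ℕ) :
    homogeneousComponent N (symbVec α T0 T1 m ⬝ᵥ fun x => C (β x)) =
      symbW α T0 T1 m N ⬝ᵥ fun p => C (cβ T0 β m p) := by
  simp only [dotProduct]
  rw [map_sum]
  simp_rw [homogeneousComponent_mul_C, symbVec_invariant α T0 T1 m m le_rfl N, Fin.is_le, if_true,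
    Finset.sum_mul]
  rw [Finset.sum_comm]
  refine Finset.sum_congr rfl fun p _ => ?_
  rw [show cβ T0 β m p = ∑ x, cprod T0 p.2 (m - p.2) p.1 x * β x from rfl, map_sum, Finset.mul_sum]
  refine Finset.sum_congr rfl fun x _ => ?_
  rw [map_mul, mul_assoc]

/-- The counter covector after `i` letters is `cα · 𝒰^i`. [folklore] -/
theorem symbW_eq_vecMul_pow (i : ℕ) :
    symbW α T0 T1 m i = (fun p => C (cα α m p)) ᵥ* symbU T0 T1 m ^ i := by
  induction i with
  | zero => rw [pow_zero, Matrix.vecMul_one]; rfl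
  | succ i ih => rw [pow_succ, ← Matrix.vecMul_vecMul, ← ih]; rfl

end Counter

end

end DetReprLift

end Summit.ValiantsHypothesis.ValiantsHypothesis.Theorems
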